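import Literature.Algebra.Polynomial.CasasAlvero.Char89Digits
import Literature.Algebra.Polynomial.CasasAlvero.Hexanomial
import Literature.Algebra.Polynomial.CasasAlvero.Degree6CandidatesPrime
import Literature.Algebra.Polynomial.CasasAlvero.Degree5
import Literature.Algebra.Polynomial.CasasAlvero.DigitReduction
import HarnessLib

/-!
# Casas-Alvero degrees in characteristic 89: the complete classification

Over EVERY field `K` of characteristic `89`: `CA_d(K) ⟺ d = 0 ∨ d = a·89^k` with `1 ≤ a ≤ 6`.
Ingredients: the digit reduction `CA_d ⇒ d = a·p^k ∧ CA_a` (`DigitReduction.lean`, any field); the positive digits `1, 2, 3, 4`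
([GrafVonBothmerEtAl2007, Props. 2, 6]), `5` (`Degree5.lean`) and `6` (`89` is not among the `54` candidate bad primes of degree `6` of `Degree6CandidatesPrime.lean`, so `CA_6` holds in characteristic `89` —
a GOOD prime for degree `6` [CastryckLaterveerOunaies2012, Thm. 4] — and `CA_{6·p^k}` descends from the algebraic closure); and a refutation of every digit `7 ≤ a ≤ 88` over every field of characteristic `89`:
`7` by the sparse `𝔽_89`-septic of `Char89Digits.lean` (the degree-7 table of `BadDegrees.lean` stops at `61`); `8` by the
`𝔽_89`-pentanomial of `Hexanomial.lean` (found by the witness-first linear search, kit job j074355 — the last digit that was missing); `20, 26, 40, 45, 49, 50, 51, 52, 59, 67, 75, 79, 85, 88` by the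
binomial criterion (`m = 7, 7, 3, 8, 3, 25, 8, 15, 21, 29, 9, 13, 39, 2`); and the 66 remaining digits by the sparse `𝔽_89`-examples of `Char89Digits.lean`.
-/

noncomputable section

open Polynomial

namespace Literature.Algebra.Polynomial.CasasAlvero

variable (K : Type*) [Field K] [CharP K 89]

/-- `CA_{6·89^k}` over every field of characteristic `89` (`k = 0`: `CA_6` — `89` is not among the `54` candidate bad primes of degree `6`
of `Degree6CandidatesPrime.lean`, i.e. it is a GOOD prime for degree `6` [CastryckLaterveerOunaies2012, Thm. 4]; then descent from the
algebraic closure). [cite: GrafVonBothmerEtAl2007, Prop. 6] [cite: CastryckLaterveerOunaies2012, Thm. 4] -/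
theorem holdsInDegree_six_mul_pow_of_char_89' (k : ℕ) : HoldsInDegree K (6 * 89 ^ k) := by
  haveI : Fact (Nat.Prime 89) := ⟨by norm_num⟩
  exact holdsInDegree_mul_prime_pow_field K 89 (holdsInDegree_six_of_not_mem (K := AlgebraicClosure K) 89 (by decide)) k

/-- every digit `7 ≤ a < 89` fails: `¬ CA_a` over every field of characteristic `89` — the bad-prime computations of
[cite: CastryckLaterveerOunaies2012, Thm. 4] (degrees `≤ 7`) extended to every digit below `89` by explicit `𝔽_89`-rational examples and the binomial
criterion. [cite: GrafVonBothmerEtAl2007, Prop. 6] -/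
theorem not_holdsInDegree_digit_of_char_eightyNine {a : ℕ} (h7 : 7 ≤ a) (hap : a < 89) : ¬ HoldsInDegree K a := by
  haveI : Fact (Nat.Prime 89) := ⟨by norm_num⟩
  interval_cases a
  · exact not_holdsInDegree_seven_of_char_89 K
  · exact not_holdsInDegree_eight_of_char_89 K
  · exact not_holdsInDegree_nine_of_char_89 K
  · exact not_holdsInDegree_ten_of_char_89 K
  · exact not_holdsInDegree_eleven_of_char_89 K
  · exact not_holdsInDegree_twelve_of_char_89 K
  · exact not_holdsInDegree_thirteen_of_char_89 K
  · exact not_holdsInDegree_fourteen_of_char_89 K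
  · exact not_holdsInDegree_fifteen_of_char_89 K
  · exact not_holdsInDegree_sixteen_of_char_89 K
  · exact not_holdsInDegree_seventeen_of_char_89 K
  · exact not_holdsInDegree_eighteen_of_char_89 K
  · exact not_holdsInDegree_nineteen_of_char_89 K
  · exact not_holdsInDegree_of_choose_modEq_one K 89 (d := 20) (m := 7) (by norm_num) (by norm_num) (by decide)
  · exact not_holdsInDegree_twentyOne_of_char_89 K
  · exact not_holdsInDegree_twentyTwo_of_char_89 K
  · exact not_holdsInDegree_twentyThree_of_char_89 K
  · exact not_holdsInDegree_twentyFour_of_char_89 K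
  · exact not_holdsInDegree_twentyFive_of_char_89 K
  · exact not_holdsInDegree_of_choose_modEq_one K 89 (d := 26) (m := 7) (by norm_num) (by norm_num) (by decide)
  · exact not_holdsInDegree_twentySeven_of_char_89 K
  · exact not_holdsInDegree_twentyEight_of_char_89 K
  · exact not_holdsInDegree_twentyNine_of_char_89 K
  · exact not_holdsInDegree_thirty_of_char_89 K
  · exact not_holdsInDegree_thirtyOne_of_char_89 K
  · exact not_holdsInDegree_thirtyTwo_of_char_89 K
  · exact not_holdsInDegree_thirtyThree_of_char_89 K
  · exact not_holdsInDegree_thirtyFour_of_char_89 K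
  · exact not_holdsInDegree_thirtyFive_of_char_89 K
  · exact not_holdsInDegree_thirtySix_of_char_89 K
  · exact not_holdsInDegree_thirtySeven_of_char_89 K
  · exact not_holdsInDegree_thirtyEight_of_char_89 K
  · exact not_holdsInDegree_thirtyNine_of_char_89 K
  · exact not_holdsInDegree_of_choose_modEq_one K 89 (d := 40) (m := 3) (by norm_num) (by norm_num) (by decide)
  · exact not_holdsInDegree_fortyOne_of_char_89 K
  · exact not_holdsInDegree_fortyTwo_of_char_89 K
  · exact not_holdsInDegree_fortyThree_of_char_89 K
  · exact not_holdsInDegree_fortyFour_of_char_89 K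
  · exact not_holdsInDegree_of_choose_modEq_one K 89 (d := 45) (m := 8) (by norm_num) (by norm_num) (by decide)
  · exact not_holdsInDegree_fortySix_of_char_89 K
  · exact not_holdsInDegree_fortySeven_of_char_89 K
  · exact not_holdsInDegree_fortyEight_of_char_89 K
  · exact not_holdsInDegree_of_choose_modEq_one K 89 (d := 49) (m := 3) (by norm_num) (by norm_num) (by decide)
  · exact not_holdsInDegree_of_choose_modEq_one K 89 (d := 50) (m := 25) (by norm_num) (by norm_num) (by decide)
  · exact not_holdsInDegree_of_choose_modEq_one K 89 (d := 51) (m := 8) (by norm_num) (by norm_num) (by decide)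
  · exact not_holdsInDegree_of_choose_modEq_one K 89 (d := 52) (m := 15) (by norm_num) (by norm_num) (by decide)
  · exact not_holdsInDegree_fiftyThree_of_char_89 K
  · exact not_holdsInDegree_fiftyFour_of_char_89 K
  · exact not_holdsInDegree_fiftyFive_of_char_89 K
  · exact not_holdsInDegree_fiftySix_of_char_89 K
  · exact not_holdsInDegree_fiftySeven_of_char_89 K
  · exact not_holdsInDegree_fiftyEight_of_char_89 K
  · exact not_holdsInDegree_of_choose_modEq_one K 89 (d := 59) (m := 21) (by norm_num) (by norm_num) (by decide)
  · exact not_holdsInDegree_sixty_of_char_89 K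
  · exact not_holdsInDegree_sixtyOne_of_char_89 K
  · exact not_holdsInDegree_sixtyTwo_of_char_89 K
  · exact not_holdsInDegree_sixtyThree_of_char_89 K
  · exact not_holdsInDegree_sixtyFour_of_char_89 K
  · exact not_holdsInDegree_sixtyFive_of_char_89 K
  · exact not_holdsInDegree_sixtySix_of_char_89 K
  · exact not_holdsInDegree_of_choose_modEq_one K 89 (d := 67) (m := 29) (by norm_num) (by norm_num) (by decide)
  · exact not_holdsInDegree_sixtyEight_of_char_89 K
  · exact not_holdsInDegree_sixtyNine_of_char_89 K
  · exact not_holdsInDegree_seventy_of_char_89 K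
  · exact not_holdsInDegree_seventyOne_of_char_89 K
  · exact not_holdsInDegree_seventyTwo_of_char_89 K
  · exact not_holdsInDegree_seventyThree_of_char_89 K
  · exact not_holdsInDegree_seventyFour_of_char_89 K
  · exact not_holdsInDegree_of_choose_modEq_one K 89 (d := 75) (m := 9) (by norm_num) (by norm_num) (by decide)
  · exact not_holdsInDegree_seventySix_of_char_89 K
  · exact not_holdsInDegree_seventySeven_of_char_89 K
  · exact not_holdsInDegree_seventyEight_of_char_89 K
  · exact not_holdsInDegree_of_choose_modEq_one K 89 (d := 79) (m := 13) (by norm_num) (by norm_num) (by decide)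
  · exact not_holdsInDegree_eighty_of_char_89 K
  · exact not_holdsInDegree_eightyOne_of_char_89 K
  · exact not_holdsInDegree_eightyTwo_of_char_89 K
  · exact not_holdsInDegree_eightyThree_of_char_89 K
  · exact not_holdsInDegree_eightyFour_of_char_89 K
  · exact not_holdsInDegree_of_choose_modEq_one K 89 (d := 85) (m := 39) (by norm_num) (by norm_num) (by decide)
  · exact not_holdsInDegree_eightySix_of_char_89 K
  · exact not_holdsInDegree_eightySeven_of_char_89 K
  · exact not_holdsInDegree_of_choose_modEq_one K 89 (d := 88) (m := 2) (by norm_num) (by norm_num) (by decide)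

/-- the positive digits `1 ≤ a ≤ 5`: `CA_{a·89^k}` over every field of characteristic `89`. [cite: GrafVonBothmerEtAl2007, Props. 2, 6]
[cite: CastryckLaterveerOunaies2012, Thm. 4] -/
theorem holdsInDegree_mul_eightyNine_pow_of_le_five {a : ℕ} (ha0 : 0 < a) (ha5 : a ≤ 5) (k : ℕ) :
    HoldsInDegree K (a * 89 ^ k) := by
  haveI : Fact (Nat.Prime 89) := ⟨by norm_num⟩
  interval_cases a
  · simpa using holdsInDegree_prime_pow_field K 89 k
  · exact holdsInDegree_two_mul_prime_pow_field K 89 k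
  · exact holdsInDegree_three_mul_prime_pow_field K 89 (by norm_num) k
  · exact holdsInDegree_mul_prime_pow_field K 89
      (holdsInDegree_of_le_four_of_charP (AlgebraicClosure K) 89 (by norm_num) le_rfl) k
  · exact holdsInDegree_five_mul_prime_pow_field K 89 (by norm_num) (by norm_num) (by norm_num) (by norm_num)
      (by norm_num) (by norm_num) (by norm_num) (by norm_num) (by norm_num) k

/-- **characteristic 89, complete**: over every field of characteristic `89`,
`CA_d ⟺ d = 0 ∨ d = a·89^k` with `1 ≤ a ≤ 6`. [cite: GrafVonBothmerEtAl2007, Props. 2, 6, 7]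
[cite: CastryckLaterveerOunaies2012, Thm. 4] -/
theorem classification_char_eightyNine_complete (d : ℕ) :
    HoldsInDegree K d ↔ d = 0 ∨ ∃ k a : ℕ, 0 < a ∧ a ≤ 6 ∧ d = a * 89 ^ k := by
  haveI : Fact (Nat.Prime 89) := ⟨by norm_num⟩
  constructor
  · intro h
    rcases Nat.eq_zero_or_pos d with rfl | hd
    · exact Or.inl rfl
    obtain ⟨k, a, ha0, hap, rfl, ha⟩ := digit_of_holdsInDegree K 89 hd.ne' h
    refine Or.inr ⟨k, a, ha0, ?_, rfl⟩
    by_contra h6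
    exact not_holdsInDegree_digit_of_char_eightyNine K (by omega) hap ha
  · rintro (rfl | ⟨k, a, ha0, ha6, rfl⟩)
    · exact holdsInDegree_zero K
    · rcases Nat.lt_or_ge a 6 with ha | ha
      · exact holdsInDegree_mul_eightyNine_pow_of_le_five K ha0 (by omega) k
      · obtain rfl : a = 6 := le_antisymm ha6 ha
        exact holdsInDegree_six_mul_pow_of_char_89' K k

/-- the set of Casas-Alvero degrees `≤ 7921` in characteristic `89`, explicitly (corollary of the classification:
[cite: GrafVonBothmerEtAl2007, Prop. 6] with [cite: CastryckLaterveerOunaies2012, Thm. 4] and the digit refutations above). -/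
theorem holdsInDegree_iff_mem_of_le_char_eightyNine_sq {d : ℕ} (hd : d ≤ 7921) :
    HoldsInDegree K d ↔ d ∈ ({0, 1, 2, 3, 4, 5, 6, 89, 178, 267, 356, 445, 534, 7921} : Finset ℕ) := by
  rw [classification_char_eightyNine_complete]
  constructor
  · rintro (rfl | ⟨k, a, ha0, ha6, rfl⟩)
    · decide
    · rcases k with _ | _ | _ | k
      · interval_cases a <;> decide
      · interval_cases a <;> decide
      · interval_cases a <;> simp_all
      · exfalso
        have : 89 ^ 3 ≤ a * 89 ^ (k + 1 + 1 + 1) :=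
          le_trans (Nat.pow_le_pow_right (by norm_num) (by omega)) (Nat.le_mul_of_pos_left _ ha0)
        omega
  · intro h
    simp only [Finset.mem_insert, Finset.mem_singleton] at h
    rcases h with rfl | rfl | rfl | rfl | rfl | rfl | rfl | rfl | rfl | rfl | rfl | rfl | rfl | rfl
    · exact Or.inl rfl
    · exact Or.inr ⟨0, 1, by norm_num, by norm_num, by norm_num⟩
    · exact Or.inr ⟨0, 2, by norm_num, by norm_num, by norm_num⟩
    · exact Or.inr ⟨0, 3, by norm_num, by norm_num, by norm_num⟩
    · exact Or.inr ⟨0, 4, by norm_num, by norm_num, by norm_num⟩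
    · exact Or.inr ⟨0, 5, by norm_num, by norm_num, by norm_num⟩
    · exact Or.inr ⟨0, 6, by norm_num, by norm_num, by norm_num⟩
    · exact Or.inr ⟨1, 1, by norm_num, by norm_num, by norm_num⟩
    · exact Or.inr ⟨1, 2, by norm_num, by norm_num, by norm_num⟩
    · exact Or.inr ⟨1, 3, by norm_num, by norm_num, by norm_num⟩
    · exact Or.inr ⟨1, 4, by norm_num, by norm_num, by norm_num⟩
    · exact Or.inr ⟨1, 5, by norm_num, by norm_num, by norm_num⟩
    · exact Or.inr ⟨1, 6, by norm_num, by norm_num, by norm_num⟩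
    · exact Or.inr ⟨2, 1, by norm_num, by norm_num, by norm_num⟩

end Literature.Algebra.Polynomial.CasasAlvero
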